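import Summits.AtomisticToContinuum.HydrodynamicLimit.Theorems.CollisionIsometryCLTMacroClosureStubThermoEos
import Summits.AtomisticToContinuum.HydrodynamicLimit.Theorems.CollisionIsometryCLTMacroClosureStubThermoIdeal

/-!
# Stub `stub_thermo` of the line `IdeatorTwoGen1Sketch` (crux `MacroClosure`, stmt-14870) —
# part 2b: coercivity of the hard-sphere relative entropy on the band (clause 2)

Support file (registered sub-goal `stub_thermo_clause2`) for the stub
`Barycentric.stub_thermo : ∃ η₃, 0 < η₃ ∧ ThermoChamber η₃`.

Clause 2 of `ThermoChamber η₃` WITHOUT the open convexity item `HsFreeEnergyConvex` (stmt-9526):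
for `U = stateOf ρ u θ` in a compact part of the dilute chamber and `V = stateOf r v s` anywhere on
the band `{0 < ρ, ρσ³ < 11/10, θ > 0}`, `relEnt_stateOf` splits `h_σ(V | U)` into the three ideal
terms (coercive by `stub_thermo_idealCoercive`) plus the Bregman divergence `T₄` of the excess part
`r ↦ r f_ex(rσ³)`, which is only known near `0`. The density term `T₁ = r log(r/ρ) − r + ρ` pays
for `T₄`: `T₁ + 2T₄ ≥ 0` because
* for `rσ³ < η_c` (the radius where `r log r + 2r f_ex(rσ³)` is convex: its second derivative is
  `(1 + 4xF′ + 2x²F″)/r ≥ 1/(2r)`, with the analytic `F` of `HsEosLowDensity`) it is a Bregman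
  divergence of a convex function;
* for `rσ³ ≥ η_c` the unknown value `f_ex(rσ³)` only enters with a plus sign (`f_ex ≥ 0`,
  `hsExcessFreeEnergy_nonneg`), the known terms are `O(C₁ η₃ r)`, and `T₁ ≥ r (log(η_c/η₃) − 1)`
  dominates once `η₃ ≤ η₂ := η_c e^{−(1 + 4C₁η_c)}`.
Hence `h_σ(V | U) ≥ (T₁ + T₂ + T₃)/2 ≥ (m/2) min(‖V − U‖², ‖V − U‖)`.
-/

noncomputable section

open MeasureTheory Filter Set Topology InformationTheory
open scoped ENNReal ContDiff

namespace Summit.AtomisticToContinuum.HydrodynamicLimit.Theorems.MacroClosureLine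

open Literature.MathematicalPhysics.KineticTheory Literature.Analysis.FluidPDE
open Literature.Analysis.FunctionSpaces

namespace Barycentric

variable {η₀ : ℝ} {F : ℝ → ℝ}

/-! ## The convexity radius and the derivative bound of the excess free energy -/

/-- **Convexity radius.** For `F` analytic near `0` there is `0 < η_c < η₀` with
`2η (2F′(η)) + η² (2F″(η)) ≥ −1/2` on `(0, η_c)` (the hypothesis of `eosEntropy_convexOn` for
`2F`; the left side is continuous and vanishes at `0`). -/
theorem exists_convexity_radius (hη₀ : 0 < η₀) (hFa : AnalyticOnNhd ℝ F (Ioo (-η₀) η₀)) :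
    ∃ η_c : ℝ, 0 < η_c ∧ η_c < η₀ ∧ ∀ η ∈ Ioo 0 η_c,
      -(1 / 2) ≤ 2 * η * (2 * deriv F η) + η ^ 2 * (2 * deriv (deriv F) η) := by
  have h0 : (0 : ℝ) ∈ Ioo (-η₀) η₀ := ⟨by linarith, hη₀⟩
  set g : ℝ → ℝ := fun η => 2 * η * (2 * deriv F η) + η ^ 2 * (2 * deriv (deriv F) η) with hg
  have hc : ContinuousAt g 0 := by
    have h1 : ContinuousAt (deriv F) 0 := (hFa.deriv 0 h0).continuousAt
    have h2 : ContinuousAt (deriv (deriv F)) 0 := (hFa.deriv.deriv 0 h0).continuousAt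
    exact ((continuousAt_const.mul continuousAt_id).mul (continuousAt_const.mul h1)).add
      ((continuousAt_id.pow 2).mul (continuousAt_const.mul h2))
  have hlt : (fun _ : ℝ => (-(1 / 2) : ℝ)) 0 < g 0 := by simp [g]
  obtain ⟨ε, hε, hball⟩ := Metric.eventually_nhds_iff.1 (continuousAt_const.eventually_lt hc hlt)
  refine ⟨min (ε / 2) (η₀ / 2), by positivity, lt_of_le_of_lt (min_le_right _ _) (by linarith),
    fun η hη => ?_⟩
  have hdist : dist η 0 < ε := by
    rw [Real.dist_eq, sub_zero, abs_lt]
    exact ⟨by linarith [hη.1], lt_of_lt_of_le hη.2 ((min_le_left _ _).trans (by linarith))⟩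
  exact (hball hdist).le

/-- **Derivative bound.** On `[0, η_c] ⊂ (−η₀, η₀)`: `|F′| ≤ C₁` and, as `F 0 = 0`, `|F x| ≤ C₁ x`
(mean value theorem). -/
theorem exists_deriv_bound (hFa : AnalyticOnNhd ℝ F (Ioo (-η₀) η₀)) (hF0 : F 0 = 0) {η_c : ℝ}
    (hc0 : 0 < η_c) (hc1 : η_c < η₀) :
    ∃ C₁ : ℝ, 0 ≤ C₁ ∧ (∀ x ∈ Icc 0 η_c, |deriv F x| ≤ C₁) ∧ ∀ x ∈ Icc 0 η_c, |F x| ≤ C₁ * x := by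
  have hsub : Icc 0 η_c ⊆ Ioo (-η₀) η₀ := fun x hx => ⟨by linarith [hx.1], lt_of_le_of_lt hx.2 hc1⟩
  have hcont : ContinuousOn (deriv F) (Icc 0 η_c) := (hFa.deriv.continuousOn).mono hsub
  obtain ⟨C, hC⟩ := (isCompact_Icc : IsCompact (Icc (0 : ℝ) η_c)).exists_bound_of_continuousOn hcont
  refine ⟨max C 0, le_max_right _ _, fun x hx => ?_, fun x hx => ?_⟩
  · exact (Real.norm_eq_abs _ ▸ hC x hx).trans (le_max_left _ _)
  · have hmvt := Convex.norm_image_sub_le_of_norm_deriv_le (𝕜 := ℝ) (f := F) (s := Icc 0 η_c)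
      (C := max C 0) (fun y hy => (hFa y (hsub hy)).differentiableAt)
      (fun y hy => (hC y hy).trans (le_max_left _ _)) (convex_Icc 0 η_c)
      (left_mem_Icc.2 hc0.le) hx
    rw [hF0, sub_zero, sub_zero, Real.norm_eq_abs, Real.norm_eq_abs, abs_of_nonneg hx.1] at hmvt
    exact hmvt

/-! ## The convex zone: `T₁ + 2 T₄ ≥ 0` by convexity of `r log r + 2 r f_ex(rσ³)` -/

/-- The tangent-line inequality for a convex function of one variable, differentiable at the
base point. -/
theorem convexOn_tangent_le {S : Set ℝ} {φ : ℝ → ℝ} (hφ : ConvexOn ℝ S φ) {x y φ' : ℝ}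
    (hx : x ∈ S) (hy : y ∈ S) (hd : HasDerivAt φ φ' x) : φ x + φ' * (y - x) ≤ φ y := by
  rcases lt_trichotomy x y with hxy | rfl | hyx
  · have h := hφ.le_slope_of_hasDerivAt hx hy hxy hd
    rw [slope_def_field, le_div_iff₀ (by linarith)] at h
    linarith
  · simp
  · have h := hφ.slope_le_of_hasDerivAt hy hx hyx hd
    rw [slope_def_field, div_le_iff₀ (by linarith)] at h
    linarith

/-- **Convexity of `r ↦ r log r + 2 r f_ex(rσ³)` on `(0, η_c/σ³)`**: the second derivative is
`(1 + 4x f_ex′(x) + 2x² F″(x))/r ≥ 1/(2r) > 0`, `x = rσ³` (second-derivative test,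
`convexOn_of_hasDerivWithinAt2_nonneg`). -/
theorem convexOn_density_excess (hFa : AnalyticOnNhd ℝ F (Ioo (-η₀) η₀))
    (hF : EqOn hsExcessFreeEnergy F (Ico 0 η₀)) {σ η_c : ℝ} (hσ : 0 < σ) (hc0 : 0 < η_c)
    (hc1 : η_c ≤ η₀)
    (hb : ∀ η ∈ Ioo 0 η_c, -(1 / 2) ≤ 2 * η * (2 * deriv F η) + η ^ 2 * (2 * deriv (deriv F) η)) :
    ConvexOn ℝ (Ioo 0 (η_c / σ ^ 3))
      (fun r => r * Real.log r + r * (2 * hsExcessFreeEnergy (r * σ ^ 3))) := by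
  have _hc : 0 < η_c / σ ^ 3 := div_pos hc0 (by positivity)
  have hσ3 : 0 < σ ^ 3 := by positivity
  have hx : ∀ r ∈ Ioo 0 (η_c / σ ^ 3), r * σ ^ 3 ∈ Ioo 0 η₀ := fun r hr =>
    ⟨mul_pos hr.1 hσ3, lt_of_lt_of_le ((lt_div_iff₀ hσ3).mp hr.2) hc1⟩
  have hxc : ∀ r ∈ Ioo 0 (η_c / σ ^ 3), r * σ ^ 3 ∈ Ioo 0 η_c := fun r hr =>
    ⟨mul_pos hr.1 hσ3, (lt_div_iff₀ hσ3).mp hr.2⟩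
  have hlin : ∀ r : ℝ, HasDerivAt (fun y : ℝ => y * σ ^ 3) (σ ^ 3) r := fun r => by
    simpa using (hasDerivAt_id r).mul_const (σ ^ 3)
  -- first derivative
  have hd1 : ∀ r ∈ Ioo 0 (η_c / σ ^ 3),
      HasDerivAt (fun r => r * Real.log r + r * (2 * hsExcessFreeEnergy (r * σ ^ 3)))
        (Real.log r + 1 + 2 * hsExcessFreeEnergy (r * σ ^ 3) +
          2 * (r * σ ^ 3) * deriv hsExcessFreeEnergy (r * σ ^ 3)) r := by
    intro r hr
    have hA := Real.hasDerivAt_mul_log hr.1.ne'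
    have hcomp : HasDerivAt (fun y => hsExcessFreeEnergy (y * σ ^ 3))
        (deriv hsExcessFreeEnergy (r * σ ^ 3) * σ ^ 3) r :=
      HasDerivAt.comp (h₂ := hsExcessFreeEnergy) r (hasDerivAt_hsExcessFreeEnergy hFa hF (hx r hr))
        (hlin r)
    refine (hA.add ((hasDerivAt_id r).mul (hcomp.const_mul 2))).congr_deriv ?_
    simp only [id]
    ring
  -- second derivative
  have hd2 : ∀ r ∈ Ioo 0 (η_c / σ ^ 3),
      HasDerivAt (fun r => Real.log r + 1 + 2 * hsExcessFreeEnergy (r * σ ^ 3) +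
          2 * (r * σ ^ 3) * deriv hsExcessFreeEnergy (r * σ ^ 3))
        (1 / r + 4 * σ ^ 3 * deriv hsExcessFreeEnergy (r * σ ^ 3) +
          2 * r * σ ^ 6 * deriv (deriv F) (r * σ ^ 3)) r := by
    intro r hr
    have hr0 : r ≠ 0 := hr.1.ne'
    have hA := ((Real.hasDerivAt_log hr0).add_const 1)
    have hcomp : HasDerivAt (fun y => hsExcessFreeEnergy (y * σ ^ 3))
        (deriv hsExcessFreeEnergy (r * σ ^ 3) * σ ^ 3) r :=
      HasDerivAt.comp (h₂ := hsExcessFreeEnergy) r (hasDerivAt_hsExcessFreeEnergy hFa hF (hx r hr))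
        (hlin r)
    have hcomp' : HasDerivAt (fun y => deriv hsExcessFreeEnergy (y * σ ^ 3))
        (deriv (deriv F) (r * σ ^ 3) * σ ^ 3) r :=
      HasDerivAt.comp (h₂ := deriv hsExcessFreeEnergy) r
        (hasDerivAt_deriv_hsExcessFreeEnergy hFa hF (hx r hr)) (hlin r)
    have hB := ((hlin r).const_mul 2).mul hcomp'
    refine ((hA.add (hcomp.const_mul 2)).add hB).congr_deriv ?_
    field_simp
    ring
  -- positivity of the second derivative
  have hnonneg : ∀ r ∈ Ioo 0 (η_c / σ ^ 3),
      0 ≤ 1 / r + 4 * σ ^ 3 * deriv hsExcessFreeEnergy (r * σ ^ 3) +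
        2 * r * σ ^ 6 * deriv (deriv F) (r * σ ^ 3) := by
    intro r hr
    have hr0 : r ≠ 0 := hr.1.ne'
    have h := hb _ (hxc r hr)
    rw [← deriv_hsExcessFreeEnergy_eq hF (hx r hr)] at h
    have key : 0 ≤ r * (1 / r + 4 * σ ^ 3 * deriv hsExcessFreeEnergy (r * σ ^ 3) +
        2 * r * σ ^ 6 * deriv (deriv F) (r * σ ^ 3)) := by
      have : r * (1 / r + 4 * σ ^ 3 * deriv hsExcessFreeEnergy (r * σ ^ 3) +
          2 * r * σ ^ 6 * deriv (deriv F) (r * σ ^ 3)) =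
          1 + (2 * (r * σ ^ 3) * (2 * deriv hsExcessFreeEnergy (r * σ ^ 3)) +
            (r * σ ^ 3) ^ 2 * (2 * deriv (deriv F) (r * σ ^ 3))) := by
        field_simp
        ring
      rw [this]
      linarith
    exact (mul_nonneg_iff_of_pos_left hr.1).mp key
  refine convexOn_of_hasDerivWithinAt2_nonneg (convex_Ioo 0 (η_c / σ ^ 3))
    (f' := fun r => Real.log r + 1 + 2 * hsExcessFreeEnergy (r * σ ^ 3) +
      2 * (r * σ ^ 3) * deriv hsExcessFreeEnergy (r * σ ^ 3))
    (f'' := fun r => 1 / r + 4 * σ ^ 3 * deriv hsExcessFreeEnergy (r * σ ^ 3) +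
      2 * r * σ ^ 6 * deriv (deriv F) (r * σ ^ 3))
    (fun r hr => (hd1 r hr).continuousAt.continuousWithinAt) ?_ ?_ ?_
  · rw [interior_Ioo]
    exact fun r hr => (hd1 r hr).hasDerivWithinAt
  · rw [interior_Ioo]
    exact fun r hr => (hd2 r hr).hasDerivWithinAt
  · rw [interior_Ioo]
    exact hnonneg

/-- **`T₁ + 2T₄ ≥ 0` in the convex zone**: for `ρ, r ∈ (0, η_c/σ³)` the sum of the density term and
twice the excess Bregman term is the Bregman divergence of the convex `r log r + 2 r f_ex(rσ³)`. -/
theorem density_excess_nonneg (hFa : AnalyticOnNhd ℝ F (Ioo (-η₀) η₀))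
    (hF : EqOn hsExcessFreeEnergy F (Ico 0 η₀)) {σ η_c ρ r : ℝ} (hσ : 0 < σ) (hc0 : 0 < η_c)
    (hc1 : η_c ≤ η₀)
    (hb : ∀ η ∈ Ioo 0 η_c, -(1 / 2) ≤ 2 * η * (2 * deriv F η) + η ^ 2 * (2 * deriv (deriv F) η))
    (hρ : ρ ∈ Ioo 0 (η_c / σ ^ 3)) (hr : r ∈ Ioo 0 (η_c / σ ^ 3)) :
    0 ≤ (r * Real.log r - r * Real.log ρ - r + ρ) +
      2 * (r * hsExcessFreeEnergy (r * σ ^ 3) - ρ * hsExcessFreeEnergy (ρ * σ ^ 3) -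
        (hsExcessFreeEnergy (ρ * σ ^ 3) + ρ * σ ^ 3 * deriv hsExcessFreeEnergy (ρ * σ ^ 3)) *
          (r - ρ)) := by
  have hconv := convexOn_density_excess hFa hF hσ hc0 hc1 hb
  have hσ3 : 0 < σ ^ 3 := by positivity
  have hx : ρ * σ ^ 3 ∈ Ioo 0 η₀ :=
    ⟨mul_pos hρ.1 hσ3, lt_of_lt_of_le ((lt_div_iff₀ hσ3).mp hρ.2) hc1⟩
  -- the derivative of the convex function at `ρ`
  have hd : HasDerivAt (fun r => r * Real.log r + r * (2 * hsExcessFreeEnergy (r * σ ^ 3)))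
      (Real.log ρ + 1 + (1 * (2 * hsExcessFreeEnergy (ρ * σ ^ 3)) +
        ρ * (2 * (deriv hsExcessFreeEnergy (ρ * σ ^ 3) * (1 * σ ^ 3))))) ρ := by
    have h1 := Real.hasDerivAt_mul_log hρ.1.ne'
    have hlin : HasDerivAt (fun r : ℝ => r * σ ^ 3) (1 * σ ^ 3) ρ := (hasDerivAt_id ρ).mul_const _
    have h2 : HasDerivAt (fun r : ℝ => 2 * hsExcessFreeEnergy (r * σ ^ 3))
        (2 * (deriv hsExcessFreeEnergy (ρ * σ ^ 3) * (1 * σ ^ 3))) ρ :=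
      (HasDerivAt.comp (h₂ := hsExcessFreeEnergy) ρ (hasDerivAt_hsExcessFreeEnergy hFa hF hx)
        hlin).const_mul 2
    exact h1.add ((hasDerivAt_id ρ).mul h2)
  have ht := convexOn_tangent_le hconv hρ hr hd
  nlinarith [ht]

/-! ## Bounds on a compact part of the chamber -/

/-- On a non-empty compact subset of the chamber the primitive variables are pinched: there are
`ρ₋, B > 0` with `ρ₋ ≤ ρ ≤ B`, `θ(U) ≤ B/ρ₋`, `|m/ρ| ≤ B/ρ₋`. -/
theorem exists_bounds_of_isCompact {σ η : ℝ} {K : Set State} (hK : IsCompact K)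
    (hKsub : K ⊆ chamber σ η) (hne : K.Nonempty) :
    ∃ ρm B : ℝ, 0 < ρm ∧ 0 < B ∧ ∀ U ∈ K, ρm ≤ U.1 ∧ U.1 ≤ B ∧ stateTemp U ≤ B / ρm ∧
      ‖U.1⁻¹ • U.2.1‖ ≤ B / ρm := by
  obtain ⟨U₀, hU₀, hmin⟩ := hK.exists_isMinOn hne continuous_fst.continuousOn
  obtain ⟨C, hC⟩ := hK.exists_bound_of_continuousOn continuous_id.continuousOn
  have hρm : 0 < U₀.1 := (hKsub hU₀).1
  refine ⟨U₀.1, max C 1, hρm, by positivity, fun U hU => ?_⟩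
  have h1 : U₀.1 ≤ U.1 := hmin hU
  have hU1 : 0 < U.1 := (hKsub hU).1
  have hnorm : ‖U‖ ≤ max C 1 := (hC U hU).trans (le_max_left _ _)
  have hfst : U.1 ≤ max C 1 := ((le_abs_self _).trans (norm_fst_le U)).trans hnorm
  have hm : ‖U.2.1‖ ≤ max C 1 := ((norm_fst_le U.2).trans (norm_snd_le U)).trans hnorm
  have hE : U.2.2 ≤ max C 1 :=
    ((le_abs_self _).trans ((norm_snd_le U.2).trans (norm_snd_le U))).trans hnorm
  have hdiv : ∀ a : ℝ, a ≤ max C 1 → a / U.1 ≤ max C 1 / U₀.1 := by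
    intro a ha
    rcases le_or_gt 0 a with ha0 | ha0
    · exact div_le_div₀ (by positivity) ha hρm h1
    · exact (div_neg_of_neg_of_pos ha0 hU1).le.trans (by positivity)
  refine ⟨h1, hfst, ?_, ?_⟩
  · unfold stateTemp
    have hq : 0 ≤ ‖U.2.1‖ ^ 2 / (2 * U.1 ^ 2) := by positivity
    have := hdiv U.2.2 hE
    have hB : 0 ≤ max C 1 / U₀.1 := by positivity
    linarith
  · rw [norm_smul, norm_inv, Real.norm_eq_abs, abs_of_pos hU1, ← div_eq_inv_mul]
    exact hdiv _ hm

/-! ## Clause 2 -/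

set_option maxHeartbeats 800000 in
/-- **Registered sub-goal `stub_thermo_clause2` of `stub_thermo`: coercivity of `h_σ(V | U)` on the
band, uniformly for `U` in compact parts of the dilute chamber** — clause 2 of `ThermoChamber η₃`
for every `η₃ ≤ η₂`, where `η₂ ≤ η₀` depends only on the `HsEosLowDensity` witness `(η₀, F)`. -/
theorem stub_thermo_clause2 : ∀ (η₀ : ℝ) (F : ℝ → ℝ), 0 < η₀ → AnalyticOnNhd ℝ F (Ioo (-η₀) η₀) →
    EqOn hsExcessFreeEnergy F (Ico 0 η₀) → F 0 = 0 →
    ∃ η₂ : ℝ, 0 < η₂ ∧ η₂ ≤ η₀ ∧ ∀ σ η₃ : ℝ, 0 < σ → η₃ ≤ η₂ →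
      ∀ K : Set State, IsCompact K → K ⊆ chamber σ η₃ → ∃ m : ℝ, 0 < m ∧ ∀ U ∈ K, ∀ V : State,
        0 < V.1 → V.1 * σ ^ 3 < 11 / 10 → ‖V.2.1‖ ^ 2 < 2 * V.1 * V.2.2 →
        m * min (‖V - U‖ ^ 2) ‖V - U‖ ≤ relEnt σ V U := by
  intro η₀ F hη₀ hFa hF hF0
  obtain ⟨η_c, hc0, hc1, hb⟩ := exists_convexity_radius hη₀ hFa
  obtain ⟨C₁, hC₁, hdF, hFx⟩ := exists_deriv_bound hFa hF0 hc0 hc1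
  set η₂ := η_c * Real.exp (-(1 + 4 * C₁ * η_c)) with hη₂_def
  have hη₂0 : 0 < η₂ := by positivity
  have hη₂c : η₂ ≤ η_c :=
    mul_le_of_le_one_right hc0.le (Real.exp_le_one_iff.2 (by linarith only [mul_nonneg hC₁ hc0.le]))
  refine ⟨η₂, hη₂0, hη₂c.trans hc1.le, fun σ η₃ hσ hη₃ K hK hKsub => ?_⟩
  rcases K.eq_empty_or_nonempty with rfl | hne
  · exact ⟨1, one_pos, fun U hU => (Set.notMem_empty U hU).elim⟩
  obtain ⟨ρm, B, hρm, hB, hbd⟩ := exists_bounds_of_isCompact hK hKsub hne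
  -- the ideal constant
  set mI := ρm * min 1 (1 / (2 * (B / ρm))) /
    (256 * (max 1 (B * (2 + B / ρm + (B / ρm) ^ 2 / 2 + 3 / 2 * (B / ρm)))) ^ 2) with hmI
  have hmI0 : 0 < mI := by positivity
  refine ⟨mI / 2, by positivity, fun U hU V hV1 hV2 hV3 => ?_⟩
  have hσ3 : 0 < σ ^ 3 := by positivity
  obtain ⟨hρ1, hρ2, hθM, huM⟩ := hbd U hU
  have hUch : U ∈ chamber σ η₃ := hKsub hU
  have hVch : V ∈ chamber σ (11 / 10) := ⟨hV1, hV2, hV3⟩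
  -- primitive variables
  set ρ := U.1 with hρ_def
  set θ := stateTemp U with hθ_def
  set u : V3 := U.1⁻¹ • U.2.1 with hu_def
  set r := V.1 with hr_def
  set s := stateTemp V with hs_def
  set v : V3 := V.1⁻¹ • V.2.1 with hv_def
  have hρ : 0 < ρ := hUch.1
  have hθ : 0 < θ := stateTemp_pos_of_mem hUch
  have hs : 0 < s := stateTemp_pos_of_mem hVch
  have hx3 : ρ * σ ^ 3 < η₃ := hUch.2.1
  have hη₃0 : 0 < η₃ := lt_trans (mul_pos hρ hσ3) hx3
  have hxc : ρ * σ ^ 3 < η_c := lt_of_lt_of_le hx3 (hη₃.trans hη₂c)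
  have hx₀ : ρ * σ ^ 3 < η₀ := lt_trans hxc hc1
  have hUeq : U = stateOf ρ u θ := (stateOf_eta hρ.ne').symm
  have hVeq : V = stateOf r v s := (stateOf_eta hV1.ne').symm
  rw [hUeq, hVeq, relEnt_stateOf hFa hF u hσ hρ hθ hx₀ hV1.ne' v s]
  -- the ideal part
  have hideal := stub_thermo_idealCoercive ρm B (B / ρm) (B / ρm) hρm (by positivity)
    (by positivity) ρ θ u hρ1 hρ2 hθ hθM huM r s v hV1 hs
  rw [← hmI] at hideal
  -- non-negativity of the thermal and kinetic parts
  have hT2 : 0 ≤ 3 / 2 * r * (s / θ - 1 - (Real.log s - Real.log θ)) := by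
    rw [← Real.log_div hs.ne' hθ.ne']
    have := thermal_nonneg (div_pos hs hθ)
    positivity
  have hT3 : 0 ≤ r * ‖v - u‖ ^ 2 / (2 * θ) := by positivity
  -- `T₁ + 2 T₄ ≥ 0`
  have hT14 : 0 ≤ (r * Real.log r - r * Real.log ρ - r + ρ) +
      2 * (r * hsExcessFreeEnergy (r * σ ^ 3) - ρ * hsExcessFreeEnergy (ρ * σ ^ 3) -
        (hsExcessFreeEnergy (ρ * σ ^ 3) + ρ * σ ^ 3 * deriv hsExcessFreeEnergy (ρ * σ ^ 3)) *
          (r - ρ)) := by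
    rcases lt_or_ge (r * σ ^ 3) η_c with hrA | hrB
    · -- convex zone
      exact density_excess_nonneg hFa hF hσ hc0 hc1.le hb
        ⟨hρ, (lt_div_iff₀ hσ3).2 hxc⟩ ⟨hV1, (lt_div_iff₀ hσ3).2 hrA⟩
    · -- far zone: the unknown `f_ex(rσ³) ≥ 0` enters with a plus sign
      have hxI : ρ * σ ^ 3 ∈ Icc 0 η_c := ⟨by positivity, hxc.le⟩
      have hfx : hsExcessFreeEnergy (ρ * σ ^ 3) = F (ρ * σ ^ 3) := hF ⟨by positivity, hx₀⟩
      have hf'x : deriv hsExcessFreeEnergy (ρ * σ ^ 3) = deriv F (ρ * σ ^ 3) :=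
        deriv_hsExcessFreeEnergy_eq hF ⟨by positivity, hx₀⟩
      have hF1 := hFx _ hxI
      have hF2 := hdF _ hxI
      have hfr : 0 ≤ hsExcessFreeEnergy (r * σ ^ 3) := HsFreeEnergyConvex.hsExcessFreeEnergy_nonneg _
      have hrρ : ρ < r := by
        by_contra h
        have : r * σ ^ 3 ≤ ρ * σ ^ 3 := mul_le_mul_of_nonneg_right (not_lt.1 h) hσ3.le
        linarith
      -- `log(r/ρ) ≥ log(η_c/η₃) ≥ 1 + 4 C₁ η_c`
      have hratio : η_c / η₃ ≤ r / ρ := by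
        rw [div_le_div_iff₀ hη₃0 hρ]
        have i1 := mul_le_mul_of_nonneg_right hrB hρ.le
        have i2 := mul_le_mul_of_nonneg_left hx3.le hV1.le
        linarith only [i1, i2]
      have hlog1 : 1 + 4 * C₁ * η_c ≤ Real.log (η_c / η₃) := by
        have h1 : η_c / η₃ ≥ η_c / η₂ := div_le_div_of_nonneg_left hc0.le hη₃0 hη₃
        have h2 : Real.log (η_c / η₂) = 1 + 4 * C₁ * η_c := by
          rw [hη₂_def, ← div_div, div_self hc0.ne', one_div, Real.log_inv, Real.log_exp]
          ring
        rw [← h2]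
        exact Real.log_le_log (by positivity) h1
      have hlog2 : Real.log (η_c / η₃) ≤ Real.log r - Real.log ρ := by
        rw [← Real.log_div hV1.ne' hρ.ne']
        exact Real.log_le_log (by positivity) hratio
      -- the bounds on the known excess terms
      rw [hfx, hf'x]
      set x := ρ * σ ^ 3 with hx_def
      have hx0 : 0 ≤ x := by positivity
      have e2 : F x ≤ C₁ * x := (abs_le.1 (hFx _ hxI)).2
      have e3 : deriv F x ≤ C₁ := (abs_le.1 (hdF _ hxI)).2
      have hxη : x ≤ η₃ := hx3.le
      have hη₃c : η₃ ≤ η_c := hη₃.trans hη₂c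
      -- `T₁ ≥ 4 C₁ η_c r + ρ`
      have k0 : r * (1 + 4 * C₁ * η_c) ≤ r * (Real.log r - Real.log ρ) :=
        mul_le_mul_of_nonneg_left (hlog1.trans hlog2) hV1.le
      -- the known excess terms are `≤ 2 C₁ η₃ r`
      have k1 : ρ * F x ≤ ρ * (C₁ * x) := mul_le_mul_of_nonneg_left e2 hρ.le
      have k2 : (F x + x * deriv F x) * (r - ρ) ≤ (2 * C₁ * x) * (r - ρ) := by
        refine mul_le_mul_of_nonneg_right ?_ (sub_pos.2 hrρ).le
        linarith only [e2, mul_le_mul_of_nonneg_left e3 hx0]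
      have k3 : ρ * (C₁ * x) + 2 * C₁ * x * (r - ρ) ≤ 2 * C₁ * η₃ * r := by
        have j1 : C₁ * x * ρ ≥ 0 := by positivity
        have j2 : C₁ * x * r ≤ C₁ * η₃ * r :=
          mul_le_mul_of_nonneg_right (mul_le_mul_of_nonneg_left hxη hC₁) hV1.le
        linarith only [j1, j2]
      have k4 : 0 ≤ r * hsExcessFreeEnergy (r * σ ^ 3) := mul_nonneg hV1.le hfr
      have k5 : C₁ * η₃ * r ≤ C₁ * η_c * r :=
        mul_le_mul_of_nonneg_right (mul_le_mul_of_nonneg_left hη₃c hC₁) hV1.le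
      linarith only [k0, k1, k2, k3, k4, k5, hρ.le]
  linarith only [hideal, hT2, hT3, hT14]

end Barycentric

end Summit.AtomisticToContinuum.HydrodynamicLimit.Theorems.MacroClosureLine

end
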